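import Mathlib.Analysis.SpecialFunctions.Trigonometric.Deriv
import Literature.MathematicalPhysics.KineticTheory.InfiniteChainVariationalCalculus
import Summits.AtomisticToContinuum.FouriersLaw.Theorems.ParityLiouvilleSeedLiouvilleForHeatOrbitMeasure
import HarnessLib

/-!
# A radiating nonlinear plane wave: regularity cannot be dropped from `LiouvilleForHeat`

Support file (`--supports stmt-AtomisticToContinuum-13980`, route `ParityLiouvilleSeed`, decl
`Summit.AtomisticToContinuum.FouriersLaw.Theses.ParityLiouvilleSeed.LiouvilleForHeat`; equally for
the crux `ZeroCurrentRigidity`, `stmt-AtomisticToContinuum-12073`).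

## The wave

For the pinned anharmonic chain `pinnedChain ω₂ lam β γ` (`U = ω₂q²/2 + lam q⁴/4`,
`V = r²/2 + βr⁴/4`) ON THE LINE `lam = 4β` the plane wave of wave number `π/2`,
`q_x(t) = ρ cos(Ωt - πx/2)`, `p_x = dq_x/dt`, `Ω² = ω₂ + 2 + 6βρ²`,
is an EXACT solution for every amplitude `ρ` (`isSolution_radiatingWave`): the cubic terms
`-lam q_x³` and `β[(q_{x+1}-q_x)³ - (q_x-q_{x-1})³]` combine to `-ρ³[(lam - 4β)cos³ + 6β cos]`, a
pure renormalisation of the frequency exactly when `lam = 4β` (`force_radiatingWave`). Its bond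
current is `j₀ = ½ρ²Ω[(sin - cos)² + βρ²(sin - cos)⁴] ≥ 0` (`bondCurrentZ_radiatingWave`) with
period average `≥ ½ρ²Ω > 0`; the lattice shift acts on it as the time shift by a quarter period
(`shift_radiatingWave`).

## Consequence

By the orbit-measure tools of `ParityLiouvilleSeedLiouvilleForHeatOrbitMeasure`, the normalised
occupation measure of one period of the wave is a shift-invariant, time-invariant (generator sense),
translation-bounded (all site moments bounded uniformly in the site) probability measure of an
ANHARMONIC pinned chain (`ω₂ > 0`, `lam = 4β > 0`, `β > 0`) with `j₀ ∈ L¹` and `∫ j₀ dν > 0`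
(`exists_radiating_state`). Hence `liouvilleForHeat_false_without_regularity` and
`zeroCurrentRigidity_false_without_regularity`: the regularity hypothesis (box relative entropies
`≤ C(n+1)` w.r.t. a Gibbs state) of `LiouvilleForHeat` and of `ZeroCurrentRigidity` cannot be
dropped, not even in the anharmonic regime — the harmonic radiating states of Spohn–Lebowitz 1977
(`lam = β = 0`) are not the only obstruction. (The orbit measure is singular — its two-site marginals
live on a curve — hence not regular, consistent with both conjectures; what the anharmonic chain at
`lam = 4β` retains of the harmonic one is exactly this one-parameter family of radiating modes.)
-/

noncomputable section

namespace Summit.AtomisticToContinuum.FouriersLaw.Theorems.ParityLiouvilleSeed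

open MeasureTheory Set Filter Topology
open scoped ENNReal
open Literature.MathematicalPhysics.KineticTheory.HeatConduction

/-! ### The radiating plane wave of the pinned chain on the line `lam = 4β` -/

/-- **The force along the wave is a renormalised harmonic force.** For the pinned chain with
`lam = 4β` and the configuration `q_y = ρ cos(Ωt - πy/2)`, if `Ω² = ω₂ + 2 + 6βρ²` then
`F_x = -Ω² q_x` at every site: the cubic terms `-4β q_x³ + β[(q_{x+1}-q_x)³ - (q_x-q_{x-1})³]`
equal `-6βρ³(cos³ + sin² cos) = -6βρ² q_x`. [folklore] -/
theorem force_radiatingWave (ω₂ β γ ρ Ω t : ℝ) (hΩ : Ω ^ 2 = ω₂ + 2 + 6 * β * ρ ^ 2) (x : ℤ) :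
    (pinnedChain ω₂ (4 * β) β γ).force
        (fun y : ℤ => (ρ * Real.cos (Ω * t - Real.pi / 2 * y), -(ρ * Ω) * Real.sin (Ω * t - Real.pi / 2 * y))) x =
      -Ω ^ 2 * (ρ * Real.cos (Ω * t - Real.pi / 2 * x)) := by
  rw [OscillatorChain.force_eq, pinnedChain_deriv_U_eq, pinnedChain_deriv_V_eq]
  dsimp only
  set φ : ℝ := Ω * t - Real.pi / 2 * (x : ℝ) with hφ
  have h1 : Real.cos (Ω * t - Real.pi / 2 * ((x + 1 : ℤ) : ℝ)) = Real.sin φ := by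
    rw [show Ω * t - Real.pi / 2 * ((x + 1 : ℤ) : ℝ) = φ - Real.pi / 2 by push_cast; ring]
    exact Real.cos_sub_pi_div_two φ
  have h2 : Real.cos (Ω * t - Real.pi / 2 * ((x - 1 : ℤ) : ℝ)) = -Real.sin φ := by
    rw [show Ω * t - Real.pi / 2 * ((x - 1 : ℤ) : ℝ) = φ + Real.pi / 2 by push_cast; ring]
    exact Real.cos_add_pi_div_two φ
  rw [h1, h2]
  have hsc := Real.sin_sq_add_cos_sq φ
  linear_combination (-6 * β * ρ ^ 3 * Real.cos φ) * hsc + (ρ * Real.cos φ) * hΩ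

/-- **The radiating plane wave is an exact solution.** For the pinned anharmonic chain with
`lam = 4β` (any `ω₂, β, γ`, any amplitude `ρ`) and `Ω² = ω₂ + 2 + 6βρ²`, the plane wave of wave
number `π/2`, `q_x(t) = ρ cos(Ωt - πx/2)`, `p_x(t) = -ρΩ sin(Ωt - πx/2)`, solves the infinite
equations of motion `q̇_x = p_x`, `ṗ_x = F_x`. [folklore] -/
theorem isSolution_radiatingWave (ω₂ β γ ρ Ω : ℝ) (hΩ : Ω ^ 2 = ω₂ + 2 + 6 * β * ρ ^ 2) :
    (pinnedChain ω₂ (4 * β) β γ).IsSolution fun t y =>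
      (ρ * Real.cos (Ω * t - Real.pi / 2 * y), -(ρ * Ω) * Real.sin (Ω * t - Real.pi / 2 * y)) := by
  intro x t
  have hlin : HasDerivAt (fun s : ℝ => Ω * s - Real.pi / 2 * (x : ℝ)) (Ω * 1) t :=
    ((hasDerivAt_id t).const_mul Ω).sub_const _
  refine ⟨?_, ?_⟩
  · show HasDerivAt (fun s => ρ * Real.cos (Ω * s - Real.pi / 2 * x))
      (-(ρ * Ω) * Real.sin (Ω * t - Real.pi / 2 * x)) t
    refine (hlin.cos.const_mul ρ).congr_deriv ?_
    ring
  · show HasDerivAt (fun s => -(ρ * Ω) * Real.sin (Ω * s - Real.pi / 2 * x))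
      ((pinnedChain ω₂ (4 * β) β γ).force
        (fun y : ℤ => (ρ * Real.cos (Ω * t - Real.pi / 2 * y), -(ρ * Ω) * Real.sin (Ω * t - Real.pi / 2 * y))) x) t
    rw [force_radiatingWave ω₂ β γ ρ Ω t hΩ x]
    refine (hlin.sin.const_mul (-(ρ * Ω))).congr_deriv ?_
    ring

/-- The lattice shift acts on the wave as the time shift by a quarter period:
`q_{x+1}(t) = q_x(t - π/(2Ω))` (`Ω ≠ 0`). [folklore] -/
theorem shift_radiatingWave {Ω : ℝ} (hΩ : Ω ≠ 0) (ρ t : ℝ) :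
    shift (fun y : ℤ => (ρ * Real.cos (Ω * t - Real.pi / 2 * y), -(ρ * Ω) * Real.sin (Ω * t - Real.pi / 2 * y))) =
      fun y : ℤ => (ρ * Real.cos (Ω * (t + -(Real.pi / (2 * Ω))) - Real.pi / 2 * y),
        -(ρ * Ω) * Real.sin (Ω * (t + -(Real.pi / (2 * Ω))) - Real.pi / 2 * y)) := by
  funext y
  have harg : Ω * t - Real.pi / 2 * ((y + 1 : ℤ) : ℝ) =
      Ω * (t + -(Real.pi / (2 * Ω))) - Real.pi / 2 * (y : ℝ) := by
    push_cast
    field_simp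
    ring
  simp only [shift]
  rw [harg]

/-- The wave is periodic in time with period `2π/Ω` (`Ω ≠ 0`). [folklore] -/
theorem periodic_radiatingWave {Ω : ℝ} (hΩ : Ω ≠ 0) (ρ : ℝ) :
    Function.Periodic (fun (t : ℝ) (y : ℤ) =>
      (ρ * Real.cos (Ω * t - Real.pi / 2 * y), -(ρ * Ω) * Real.sin (Ω * t - Real.pi / 2 * y)))
      (2 * Real.pi / Ω) := by
  intro t
  funext y
  have harg : Ω * (t + 2 * Real.pi / Ω) - Real.pi / 2 * (y : ℝ) =
      Ω * t - Real.pi / 2 * (y : ℝ) + 2 * Real.pi := by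
    field_simp
    ring
  simp only [harg, Real.cos_add_two_pi, Real.sin_add_two_pi]

/-- **The bond current of the wave** through the bond `(0, 1)`:
`j₀ = ½ρ²Ω[(sin Ωt - cos Ωt)² + βρ²(sin Ωt - cos Ωt)⁴]`. [folklore] -/
theorem bondCurrentZ_radiatingWave (ω₂ lam β γ ρ Ω t : ℝ) :
    (pinnedChain ω₂ lam β γ).bondCurrentZ
        (fun y : ℤ => (ρ * Real.cos (Ω * t - Real.pi / 2 * y), -(ρ * Ω) * Real.sin (Ω * t - Real.pi / 2 * y))) 0 =
      ρ ^ 2 * Ω / 2 * ((Real.sin (Ω * t) - Real.cos (Ω * t)) ^ 2 +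
        β * ρ ^ 2 * (Real.sin (Ω * t) - Real.cos (Ω * t)) ^ 4) := by
  rw [OscillatorChain.bondCurrentZ, pinnedChain_deriv_V_eq]
  dsimp only
  have h0 : Ω * t - Real.pi / 2 * ((0 : ℤ) : ℝ) = Ω * t := by push_cast; ring
  have h1 : Ω * t - Real.pi / 2 * ((0 + 1 : ℤ) : ℝ) = Ω * t - Real.pi / 2 := by push_cast; ring
  rw [h0, h1, Real.cos_sub_pi_div_two, Real.sin_sub_pi_div_two]
  ring

/-- The period integral of `(sin Ωs - cos Ωs)²` over `[0, 2π/Ω]` is the period (`Ω ≠ 0`):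
antiderivative `s - sin²(Ωs)/Ω`. [folklore] -/
theorem intervalIntegral_sin_sub_cos_sq {Ω : ℝ} (hΩ : Ω ≠ 0) :
    ∫ s in (0 : ℝ)..(2 * Real.pi / Ω), (Real.sin (Ω * s) - Real.cos (Ω * s)) ^ 2 = 2 * Real.pi / Ω := by
  have hderiv : ∀ s : ℝ, HasDerivAt (fun s : ℝ => s - Real.sin (Ω * s) ^ 2 / Ω)
      ((Real.sin (Ω * s) - Real.cos (Ω * s)) ^ 2) s := by
    intro s
    have hl : HasDerivAt (fun s : ℝ => Ω * s) (Ω * 1) s := (hasDerivAt_id s).const_mul Ω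
    refine ((hasDerivAt_id s).sub ((hl.sin.pow 2).div_const Ω)).congr_deriv ?_
    have hsc := Real.sin_sq_add_cos_sq (Ω * s)
    field_simp
    linear_combination -hsc
  rw [intervalIntegral.integral_eq_sub_of_hasDerivAt (fun s _ => hderiv s)
    (Continuous.intervalIntegrable (by fun_prop) _ _)]
  have h2 : Ω * (2 * Real.pi / Ω) = 2 * Real.pi := by field_simp
  simp [h2, Real.sin_two_pi]

/-! ### The radiating state -/

/-- **A radiating space-time-invariant translation-bounded state of the anharmonic pinned chain.**
For `ω₂ > 0`, `β ≥ 0`, any bath constant `γ` and any amplitude `ρ ≠ 0`, the pinned chain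
`pinnedChain ω₂ (4β) β γ` (on-site `ω₂q²/2 + βq⁴`, coupling `r²/2 + βr⁴/4`) admits a probability
measure `ν` on `(ℝ × ℝ)^ℤ` — the normalised occupation measure of one period of the radiating plane
wave `q_x(t) = ρ cos(Ωt - πx/2)`, `Ω = √(ω₂ + 2 + 6βρ²)` — which is shift invariant, time invariant
in the generator sense (`IsTimeInvariant`), translation bounded (every site moment of order `m` is at
most `|ρ|^m + (|ρ|Ω)^m`), has `j₀ ∈ L¹(ν)`, and carries the strictly positive mean energy current
`∫ j₀ dν ≥ ½ρ²Ω > 0`. [folklore] -/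
theorem exists_radiating_state (ω₂ β γ ρ : ℝ) (hω : 0 < ω₂) (hβ : 0 ≤ β) (hρ : ρ ≠ 0) :
    ∃ ν : Measure ChainConfig, IsProbabilityMeasure ν ∧ IsShiftInvariant ν ∧
      IsTimeInvariant (pinnedChain ω₂ (4 * β) β γ) ν ∧
      (∀ m : ℕ, ∃ C : ℝ, ∀ x : ℤ,
        Integrable (fun σ : ChainConfig => |(σ x).1| ^ m + |(σ x).2| ^ m) ν ∧
          ∫ σ, (|(σ x).1| ^ m + |(σ x).2| ^ m) ∂ν ≤ C) ∧
      Integrable (fun σ => (pinnedChain ω₂ (4 * β) β γ).bondCurrentZ σ 0) ν ∧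
      0 < ∫ σ, (pinnedChain ω₂ (4 * β) β γ).bondCurrentZ σ 0 ∂ν := by
  set P := pinnedChain ω₂ (4 * β) β γ with hP
  have hA : 0 < ω₂ + 2 + 6 * β * ρ ^ 2 := by positivity
  set Ω := Real.sqrt (ω₂ + 2 + 6 * β * ρ ^ 2) with hΩdef
  have hΩpos : 0 < Ω := Real.sqrt_pos.mpr hA
  have hΩ0 : Ω ≠ 0 := hΩpos.ne'
  have hΩsq : Ω ^ 2 = ω₂ + 2 + 6 * β * ρ ^ 2 := Real.sq_sqrt hA.le
  set w : ℝ → ChainConfig := fun t y =>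
    (ρ * Real.cos (Ω * t - Real.pi / 2 * y), -(ρ * Ω) * Real.sin (Ω * t - Real.pi / 2 * y)) with hw
  have hsol : P.IsSolution w := isSolution_radiatingWave ω₂ β γ ρ Ω hΩsq
  have hwc : Continuous w := continuous_of_isSolution hsol
  have hwm : Measurable w := measurable_of_continuous_chainConfig hwc
  set τ : ℝ := 2 * Real.pi / Ω with hτdef
  have hτ : 0 < τ := div_pos Real.two_pi_pos hΩpos
  have hper : Function.Periodic w τ := periodic_radiatingWave hΩ0 ρ
  have hcl : w τ = w 0 := by simpa using hper 0
  have hU : ContDiff ℝ 2 P.U := by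
    show ContDiff ℝ 2 fun q : ℝ => ω₂ * q ^ 2 / 2 + 4 * β * q ^ 4 / 4
    fun_prop
  have hV : ContDiff ℝ 2 P.V := by
    show ContDiff ℝ 2 fun r : ℝ => r ^ 2 / 2 + β * r ^ 4 / 4
    fun_prop
  -- the bond current along the wave
  have hformula : ∀ s : ℝ, P.bondCurrentZ (w s) 0 = ρ ^ 2 * Ω / 2 *
      ((Real.sin (Ω * s) - Real.cos (Ω * s)) ^ 2 + β * ρ ^ 2 * (Real.sin (Ω * s) - Real.cos (Ω * s)) ^ 4) :=
    fun s => bondCurrentZ_radiatingWave ω₂ (4 * β) β γ ρ Ω s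
  have hjc : Continuous fun s => P.bondCurrentZ (w s) 0 := by
    rw [show (fun s => P.bondCurrentZ (w s) 0) = fun s => ρ ^ 2 * Ω / 2 *
      ((Real.sin (Ω * s) - Real.cos (Ω * s)) ^ 2 + β * ρ ^ 2 * (Real.sin (Ω * s) - Real.cos (Ω * s)) ^ 4)
      from funext hformula]
    fun_prop
  have hlow : ∀ s : ℝ, ρ ^ 2 * Ω / 2 * (Real.sin (Ω * s) - Real.cos (Ω * s)) ^ 2 ≤ P.bondCurrentZ (w s) 0 := by
    intro s
    rw [hformula s]
    have h1 : 0 ≤ ρ ^ 2 * Ω / 2 := by positivity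
    have h2 : 0 ≤ β * ρ ^ 2 * (Real.sin (Ω * s) - Real.cos (Ω * s)) ^ 4 := by positivity
    nlinarith
  refine ⟨(ENNReal.ofReal τ)⁻¹ • (volume.restrict (Ioc (0 : ℝ) τ)).map w,
    isProbabilityMeasure_orbitMeasure hwm hτ, ?_, ?_, ?_, ?_, ?_⟩
  · exact isShiftInvariant_orbitMeasure hwc hτ hper (c := -(Real.pi / (2 * Ω)))
      fun t => shift_radiatingWave hΩ0 ρ t
  · exact isTimeInvariant_smul_measure (isTimeInvariant_map_restrict_of_isSolution hU hV hsol hτ.le hcl)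
      (ENNReal.inv_ne_top.mpr (ENNReal.ofReal_pos.mpr hτ).ne')
  · intro m
    refine ⟨|ρ| ^ m + (|ρ| * Ω) ^ m, fun x => ?_⟩
    have hq : Measurable fun σ : ChainConfig => (σ x).1 := (measurable_pi_apply x).fst
    have hp : Measurable fun σ : ChainConfig => (σ x).2 := (measurable_pi_apply x).snd
    have hFm : Measurable fun σ : ChainConfig => |(σ x).1| ^ m + |(σ x).2| ^ m :=
      ((continuous_abs.measurable.comp hq).pow_const m).add ((continuous_abs.measurable.comp hp).pow_const m)
    have hx : Continuous fun s => w s x := (continuous_apply x).comp hwc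
    have hFc : Continuous fun s => |(w s x).1| ^ m + |(w s x).2| ^ m :=
      ((continuous_abs.comp (continuous_fst.comp hx)).pow m).add
        ((continuous_abs.comp (continuous_snd.comp hx)).pow m)
    have hbd : ∀ s, |(w s x).1| ^ m + |(w s x).2| ^ m ≤ |ρ| ^ m + (|ρ| * Ω) ^ m := by
      intro s
      have h1 : |(w s x).1| ≤ |ρ| := by
        show |ρ * Real.cos (Ω * s - Real.pi / 2 * x)| ≤ |ρ|
        rw [abs_mul]
        exact mul_le_of_le_one_right (abs_nonneg _) (Real.abs_cos_le_one _)
      have h2 : |(w s x).2| ≤ |ρ| * Ω := by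
        show |-(ρ * Ω) * Real.sin (Ω * s - Real.pi / 2 * x)| ≤ |ρ| * Ω
        rw [abs_mul, abs_neg, abs_mul, abs_of_pos hΩpos]
        exact mul_le_of_le_one_right (by positivity) (Real.abs_sin_le_one _)
      exact add_le_add (pow_le_pow_left₀ (abs_nonneg _) h1 m) (pow_le_pow_left₀ (abs_nonneg _) h2 m)
    refine ⟨integrable_orbitMeasure hwm hτ hFm hFc, ?_⟩
    rw [integral_orbitMeasure hwm hτ hFm]
    have hint : ∫ s in (0 : ℝ)..τ, (|(w s x).1| ^ m + |(w s x).2| ^ m) ≤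
        ∫ _ in (0 : ℝ)..τ, (|ρ| ^ m + (|ρ| * Ω) ^ m) :=
      intervalIntegral.integral_mono_on hτ.le (hFc.intervalIntegrable _ _)
        (continuous_const.intervalIntegrable _ _) fun s _ => hbd s
    rw [intervalIntegral.integral_const, smul_eq_mul, sub_zero] at hint
    calc τ⁻¹ * ∫ s in (0 : ℝ)..τ, (|(w s x).1| ^ m + |(w s x).2| ^ m)
        ≤ τ⁻¹ * (τ * (|ρ| ^ m + (|ρ| * Ω) ^ m)) := mul_le_mul_of_nonneg_left hint (inv_nonneg.mpr hτ.le)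
      _ = |ρ| ^ m + (|ρ| * Ω) ^ m := by field_simp
  · exact integrable_orbitMeasure hwm hτ (measurable_bondCurrentZ P 0) hjc
  · rw [integral_orbitMeasure hwm hτ (measurable_bondCurrentZ P 0)]
    have hmono : ∫ s in (0 : ℝ)..τ, ρ ^ 2 * Ω / 2 * (Real.sin (Ω * s) - Real.cos (Ω * s)) ^ 2 ≤
        ∫ s in (0 : ℝ)..τ, P.bondCurrentZ (w s) 0 :=
      intervalIntegral.integral_mono_on hτ.le (Continuous.intervalIntegrable (by fun_prop) _ _)
        (hjc.intervalIntegrable _ _) fun s _ => hlow s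
    rw [intervalIntegral.integral_const_mul, hτdef, intervalIntegral_sin_sub_cos_sq hΩ0] at hmono
    have hpos : 0 < (2 * Real.pi / Ω)⁻¹ * (ρ ^ 2 * Ω / 2 * (2 * Real.pi / Ω)) := by positivity
    exact hpos.trans_le (mul_le_mul_of_nonneg_left hmono (inv_nonneg.mpr hτ.le))

/-! ### Regularity cannot be dropped -/

/-- **Space-time invariance and translation-boundedness do not force a vanishing current.** It is
FALSE that for all `ω₂, lam, β > 0` every shift-invariant, time-invariant (generator sense),
translation-bounded probability measure of the infinite pinned anharmonic chain with `j₀ ∈ L¹` has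
`∫ j₀ = 0`: the radiating state of `exists_radiating_state` at `(ω₂, lam, β) = (1, 4, 1)` is a
counterexample. Hence the REGULARITY hypothesis (box relative entropies `≤ C(n+1)` w.r.t. a Gibbs
state) is necessary in both `LiouvilleForHeat` and `ZeroCurrentRigidity`, even in the anharmonic
regime. [folklore] -/
theorem spaceTimeInvariant_translationBounded_current_ne_zero :
    ¬ (∀ ω₂ lam β γ : ℝ, 0 < ω₂ → 0 < lam → 0 < β → ∀ ν : Measure ChainConfig,
        IsProbabilityMeasure ν → IsShiftInvariant ν → IsTimeInvariant (pinnedChain ω₂ lam β γ) ν →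
        (∀ m : ℕ, ∃ C : ℝ, ∀ x : ℤ,
          Integrable (fun σ : ChainConfig => |(σ x).1| ^ m + |(σ x).2| ^ m) ν ∧
            ∫ σ, (|(σ x).1| ^ m + |(σ x).2| ^ m) ∂ν ≤ C) →
        Integrable (fun σ => (pinnedChain ω₂ lam β γ).bondCurrentZ σ 0) ν →
        ∫ σ, (pinnedChain ω₂ lam β γ).bondCurrentZ σ 0 ∂ν = 0) := by
  intro h
  obtain ⟨ν, hν, hS, hT, hM, hI, hpos⟩ := exists_radiating_state 1 1 0 1 one_pos zero_le_one one_ne_zero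
  have h0 := h 1 (4 * 1) 1 0 one_pos (by norm_num) one_pos ν hν hS hT hM hI
  exact hpos.ne' h0

/-- **`LiouvilleForHeat` without regularity is false.** The statement of the route decl
`Summit.AtomisticToContinuum.FouriersLaw.Theses.ParityLiouvilleSeed.LiouvilleForHeat` with its
regularity hypothesis (uniform box relative entropy bound w.r.t. one shift-invariant Gibbs state)
deleted fails — witnessed by the radiating plane wave of the anharmonic chain `pinnedChain 1 4 1 γ`,
not only by the harmonic radiating states of Spohn–Lebowitz 1977. [folklore] -/
theorem liouvilleForHeat_false_without_regularity :
    ¬ (∀ ω₂ lam β γ : ℝ, 0 < ω₂ → 0 < lam → 0 < β → ∀ ν : Measure ChainConfig,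
        IsProbabilityMeasure ν → IsTimeInvariant (pinnedChain ω₂ lam β γ) ν →
        (∀ m : ℕ, ∃ C : ℝ, ∀ x : ℤ,
          Integrable (fun σ : ChainConfig => |(σ x).1| ^ m + |(σ x).2| ^ m) ν ∧
            ∫ σ, (|(σ x).1| ^ m + |(σ x).2| ^ m) ∂ν ≤ C) →
        Integrable (fun σ => (pinnedChain ω₂ lam β γ).bondCurrentZ σ 0) ν →
        ∫ σ, (pinnedChain ω₂ lam β γ).bondCurrentZ σ 0 ∂ν = 0) := fun h =>
  spaceTimeInvariant_translationBounded_current_ne_zero fun ω₂ lam β γ hω hl hβ ν hν _ hT hM hI =>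
    h ω₂ lam β γ hω hl hβ ν hν hT hM hI

/-- **`ZeroCurrentRigidity` without regularity is false.** The statement of the crux
`Summit.AtomisticToContinuum.FouriersLaw.Theses.ParityLiouvilleSeed.ZeroCurrentRigidity`
(`stmt-AtomisticToContinuum-12073`) with its hypothesis `IsRegular` deleted fails, for the
anharmonic chain `pinnedChain 1 4 1 γ` (radiating plane wave). [folklore] -/
theorem zeroCurrentRigidity_false_without_regularity :
    ¬ (∀ ω₂ lam β γ : ℝ, 0 < ω₂ → 0 < lam → 0 < β → ∀ ν : Measure ChainConfig,
        IsProbabilityMeasure ν → IsShiftInvariant ν → IsTimeInvariant (pinnedChain ω₂ lam β γ) ν →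
        Integrable (fun σ => (pinnedChain ω₂ lam β γ).bondCurrentZ σ 0) ν →
        ∫ σ, (pinnedChain ω₂ lam β γ).bondCurrentZ σ 0 ∂ν = 0) := fun h =>
  spaceTimeInvariant_translationBounded_current_ne_zero fun ω₂ lam β γ hω hl hβ ν hν hS hT _ hI =>
    h ω₂ lam β γ hω hl hβ ν hν hS hT hI

end Summit.AtomisticToContinuum.FouriersLaw.Theorems.ParityLiouvilleSeed

end
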